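import Mathlib
import Summits.Ventures.PercRepro2.Defs
import Summits.Ventures.PercRepro2.Graph
import Summits.Ventures.PercRepro2.Harris
import Summits.Ventures.PercRepro2.Events
import Summits.Ventures.PercRepro2.Independence
import Summits.Ventures.PercRepro2.Induced
import Summits.Ventures.PercRepro2.ContractDefs
import Summits.Ventures.PercRepro2.GateDefs
import Summits.Ventures.PercRepro2.HullTree
import Summits.Ventures.PercRepro2.GateFeedbackForest
import Summits.Ventures.PercRepro2.GateFeedbackGeneral

/-!
# The feedback-vertex gate for an avoided SET: contracting `T` to a representative
(blind cell PercRepro2, mine-c g10; proofs/MINEC-FEEDBACK.md §6)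

Row 2′CON-W is stated for an arbitrary avoided set `T`; the kernel theorems of g9
(`GateFeedback.gateRow_general_of_isForest_del` / `_exit`) are for a single avoided vertex `t`.
This file lifts them to every avoided set `T` by CONTRACTION (typer-1's `Contract.contractEnds`):
pick `t₀ ∈ T` and send every vertex of `T` to `t₀` (same vertex and edge types, same weights; the
other vertices of `T` become isolated). On `R_T = {s ↮ T}` nothing seen by the gate changes:

* `s ↝_{G/T} t₀ ↔ C_G(s) hits T` (`conn_contract_rep_iff`), so `R_{t₀}(G/T) = R_T(G)`
  (`avoidAll_contract_rep`);
* on `R_T` the root cluster is unchanged (`conn_contract_iff_of_avoid`), so the marker events and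
  the entry event `{C(s) hits A}` are unchanged;
* `w ∈ hull_G(T) ↔ w ↝_{G/T} t₀` for `w ∉ T` (`hitsK_contract_rep`);

hence the gate events coincide (`gateEvent_contract_rep`) and the cleared gate expressions are
literally equal (`gateRow_contract_rep_iff`). The forest part of `G/T` at `t₀` is `G − T`
(`Ft_contract_eq`, `isForest_endsF_contract`), so:

**THEOREM** (`gateRow_of_isForest_del_set`): if `G − T` is a forest — every cycle of `G` meets the
avoided set `T` (e.g. `T` a feedback vertex set) — then `(GATE A,{w})` holds for every root
`s ∉ T`, markers `a, b`, entry set `A` and exit vertex `w ∉ T`.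
The exit version (`(G/T) − w` a forest) is `GateContractExit.gateRow_of_isForest_del_exit_set`.
-/

namespace Summit.Ventures.PercRepro2

namespace GateContract

open scoped Classical

variable {V : Type*} {E : Type*}

/-! ## Connections in `G/T` seen from the root -/

section Conn

variable {ends : E → Sym2 V} {T : Finset V} {t₀ : V} {ω : Config E}

/-- A vertex with no incident edge is connected only to itself. -/
lemma eq_of_conn_of_isolated {ends' : E → Sym2 V} {v : V} (hv : ∀ e, v ∉ ends' e) {x : V}
    (h : Conn ends' ω x v) : x = v := by
  obtain ⟨q⟩ := h
  cases hq : q.reverse with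
  | nil => rfl
  | cons hadj r =>
    rw [openGraph_adj] at hadj
    obtain ⟨_, e, _, hends⟩ := hadj
    exact (hv e (by rw [hends]; exact Sym2.mem_mk_left _ _)).elim

/-- The vertices of `T ∖ {t₀}` are isolated in `G/T`. -/
lemma not_mem_contractEnds {v : V} (hv : v ∈ T) (hv₀ : v ≠ t₀) (e : E) :
    v ∉ Contract.contractEnds ends T t₀ e := by
  rw [Contract.contractEnds_apply]
  intro hmem
  obtain ⟨y, _, hyv⟩ := Sym2.mem_map.1 hmem
  rcases Contract.contractMap_mem_or (W := T) (w₀ := t₀) y with h1 | h1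
  · exact hv₀ (hyv ▸ h1)
  · exact h1 (hyv ▸ hv)

/-- **Connection to the representative**: for `s ∉ T`, `s ↝_{G/T} t₀ ↔ C_G(s) hits T`. -/
theorem conn_contract_rep_iff (ht₀ : t₀ ∈ T) {s : V} (hs : s ∉ T) :
    Conn (Contract.contractEnds ends T t₀) ω s t₀ ↔ ∃ t ∈ T, Conn ends ω s t := by
  constructor
  · intro h
    -- the closed set: `G`-reachable from `s`, or reached through `T`
    let S : Set V := {z | Conn ends ω s z ∨ ((∃ t ∈ T, Conn ends ω s t) ∧ ∃ t ∈ T, Conn ends ω t z)}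
    have step : ∀ {y y' : V}, OpenAdj ends ω y y' → Contract.contractMap T t₀ y ∈ S →
        Contract.contractMap T t₀ y' ∈ S := by
      intro y y' hadj hz
      have hyy' : Conn ends ω y y' := conn_of_openAdj hadj
      by_cases hy : y ∈ T <;> by_cases hy' : y' ∈ T
      · rw [Contract.contractMap_of_mem hy']
        rw [Contract.contractMap_of_mem hy] at hz
        exact hz
      · rw [Contract.contractMap_of_mem hy] at hz
        rw [Contract.contractMap_of_notMem hy']
        have hits : ∃ t ∈ T, Conn ends ω s t := by
          rcases hz with hz | ⟨hits, _⟩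
          · exact ⟨t₀, ht₀, hz⟩
          · exact hits
        exact Or.inr ⟨hits, y, hy, hyy'⟩
      · rw [Contract.contractMap_of_notMem hy] at hz
        rw [Contract.contractMap_of_mem hy']
        have hits : ∃ t ∈ T, Conn ends ω s t := by
          rcases hz with hz | ⟨hits, _⟩
          · exact ⟨y', hy', conn_trans hz hyy'⟩
          · exact hits
        exact Or.inr ⟨hits, t₀, ht₀, conn_refl ends ω t₀⟩
      · rw [Contract.contractMap_of_notMem hy] at hz
        rw [Contract.contractMap_of_notMem hy']
        rcases hz with hz | ⟨hits, t, ht, htz⟩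
        · exact Or.inl (conn_trans hz hyy')
        · exact Or.inr ⟨hits, t, ht, conn_trans htz hyy'⟩
    have hS : ∀ z ∈ S, ∀ z', (openGraph (Contract.contractEnds ends T t₀) ω).Adj z z' → z' ∈ S := by
      intro z hz z' hzz'
      obtain ⟨_, e, he, hends⟩ := openGraph_adj.1 hzz'
      obtain ⟨y, y', hyy'⟩ : ∃ y y', ends e = s(y, y') :=
        (Sym2.exists (f := fun x => ends e = x)).1 ⟨ends e, rfl⟩
      rw [Contract.contractEnds_apply, hyy', Sym2.map_mk, Sym2.eq_iff] at hends
      rcases hends with ⟨h1, h2⟩ | ⟨h1, h2⟩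
      · rw [← h2]
        exact step ⟨e, he, hyy'⟩ (h1 ▸ hz)
      · rw [← h1]
        exact step ⟨e, he, by rw [hyy', Sym2.eq_swap]⟩ (h2 ▸ hz)
    have hmem : t₀ ∈ S := mem_of_conn_of_closed hS (Or.inl (conn_refl ends ω s)) h
    rcases hmem with h | ⟨hits, _⟩
    · exact ⟨t₀, ht₀, h⟩
    · exact hits
  · rintro ⟨t, ht, h⟩
    have := Contract.conn_contract_of_conn (W := T) (w₀ := t₀) h
    rwa [Contract.contractMap_of_notMem hs, Contract.contractMap_of_mem ht] at this

/-- **On `R_T` the root cluster is unchanged by the contraction of `T`.** -/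
theorem conn_contract_iff_of_avoid (ht₀ : t₀ ∈ T) {s : V} (hs : s ∉ T)
    (hω : ω ∈ avoidAll ends s T) (v : V) :
    Conn (Contract.contractEnds ends T t₀) ω s v ↔ Conn ends ω s v := by
  by_cases hv : v ∈ T
  · constructor
    · intro h
      by_cases hv₀ : v = t₀
      · subst hv₀
        obtain ⟨t, ht, hc⟩ := (conn_contract_rep_iff ht₀ hs).1 h
        exact (hω t ht hc).elim
      · have hsv := eq_of_conn_of_isolated (not_mem_contractEnds hv hv₀) h
        subst hsv
        exact (hs hv).elim
    · intro h
      exact (hω v hv h).elim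
  · rw [Contract.conn_contract_iff ht₀ hs hv]
    constructor
    · rintro (h | ⟨⟨t, ht, hc⟩, _⟩)
      · exact h
      · exact (hω t ht hc).elim
    · exact Or.inl

end Conn

/-! ## The gate events of `G/T` at `t₀` are the gate events of `G` at `T` -/

section Events

variable {ends : E → Sym2 V} {T : Finset V} {t₀ : V}

/-- `R_{t₀}(G/T) = R_T(G)`. -/
theorem avoidAll_contract_rep (ht₀ : t₀ ∈ T) {s : V} (hs : s ∉ T) :
    avoidAll (Contract.contractEnds ends T t₀) s {t₀} = avoidAll ends s T := by
  ext ω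
  simp only [avoidAll, Set.mem_setOf_eq, Finset.mem_singleton, forall_eq]
  rw [conn_contract_rep_iff ht₀ hs]
  constructor
  · intro h t ht hc
    exact h ⟨t, ht, hc⟩
  · rintro h ⟨t, ht, hc⟩
    exact h t ht hc

/-- The marker events on `R_T` are unchanged. -/
theorem connAll_inter_avoidAll_contract_rep (ht₀ : t₀ ∈ T) {s : V} (hs : s ∉ T) (X : Finset V) :
    connAll (Contract.contractEnds ends T t₀) s X ∩
        avoidAll (Contract.contractEnds ends T t₀) s {t₀} =
      connAll ends s X ∩ avoidAll ends s T := by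
  rw [avoidAll_contract_rep ht₀ hs]
  ext ω
  simp only [Set.mem_inter_iff, connAll, Set.mem_setOf_eq]
  constructor
  · rintro ⟨h, hω⟩
    exact ⟨fun x hx => (conn_contract_iff_of_avoid ht₀ hs hω x).1 (h x hx), hω⟩
  · rintro ⟨h, hω⟩
    exact ⟨fun x hx => (conn_contract_iff_of_avoid ht₀ hs hω x).2 (h x hx), hω⟩

/-- `w ∈ hull_G(T) ↔ w ↝_{G/T} t₀` for `w ∉ T`. -/
theorem hitsK_contract_rep (ht₀ : t₀ ∈ T) {w : V} (hw : w ∉ T) :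
    Gate.hitsK (Contract.contractEnds ends T t₀) {t₀} {w} = Gate.hitsK ends T {w} := by
  ext ω
  simp only [Gate.hitsK, Set.mem_setOf_eq, Finset.mem_singleton, exists_eq_left]
  constructor
  · intro h
    obtain ⟨t, ht, hc⟩ := (conn_contract_rep_iff ht₀ hw).1 (conn_symm h)
    exact ⟨t, ht, conn_symm hc⟩
  · rintro ⟨t, ht, hc⟩
    exact conn_symm ((conn_contract_rep_iff ht₀ hw).2 ⟨t, ht, conn_symm hc⟩)

/-- **The gate events coincide**: `gateEvent_{G/T}(s, {t₀}, A, {w}) = gateEvent_G(s, T, A, {w})`. -/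
theorem gateEvent_contract_rep (ht₀ : t₀ ∈ T) {s : V} (hs : s ∉ T) {w : V} (hw : w ∉ T)
    (A : Finset V) :
    Gate.gateEvent (Contract.contractEnds ends T t₀) s {t₀} A {w} =
      Gate.gateEvent ends s T A {w} := by
  ext ω
  simp only [Gate.gateEvent, Set.mem_inter_iff, Set.mem_compl_iff]
  rw [avoidAll_contract_rep ht₀ hs, hitsK_contract_rep ht₀ hw]
  constructor
  · rintro ⟨hω, hn⟩
    refine ⟨hω, fun ⟨hS, hK⟩ => hn ⟨?_, hK⟩⟩
    obtain ⟨u, hu, hc⟩ := hS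
    exact ⟨u, hu, (conn_contract_iff_of_avoid ht₀ hs hω u).2 hc⟩
  · rintro ⟨hω, hn⟩
    refine ⟨hω, fun ⟨hS, hK⟩ => hn ⟨?_, hK⟩⟩
    obtain ⟨u, hu, hc⟩ := hS
    exact ⟨u, hu, (conn_contract_iff_of_avoid ht₀ hs hω u).1 hc⟩

/-- The marker events on the gate event are unchanged. -/
theorem connAll_inter_gateEvent_contract_rep (ht₀ : t₀ ∈ T) {s : V} (hs : s ∉ T) {w : V}
    (hw : w ∉ T) (A : Finset V) (X : Finset V) :
    connAll (Contract.contractEnds ends T t₀) s X ∩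
        Gate.gateEvent (Contract.contractEnds ends T t₀) s {t₀} A {w} =
      connAll ends s X ∩ Gate.gateEvent ends s T A {w} := by
  rw [gateEvent_contract_rep ht₀ hs hw A]
  ext ω
  simp only [Set.mem_inter_iff, connAll, Set.mem_setOf_eq]
  constructor
  · rintro ⟨h, hg⟩
    have hω : ω ∈ avoidAll ends s T := Gate.gateEvent_subset ends s T A {w} hg
    exact ⟨fun x hx => (conn_contract_iff_of_avoid ht₀ hs hω x).1 (h x hx), hg⟩
  · rintro ⟨h, hg⟩
    have hω : ω ∈ avoidAll ends s T := Gate.gateEvent_subset ends s T A {w} hg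
    exact ⟨fun x hx => (conn_contract_iff_of_avoid ht₀ hs hω x).2 (h x hx), hg⟩

end Events

/-! ## The cleared gate expression is invariant -/

section Row

variable [Fintype E] {R : Type*} [Field R] [LinearOrder R]
variable {ends : E → Sym2 V} {T : Finset V} {t₀ : V}

/-- **(GATE A,{w}) for `G` at the avoided set `T` is (GATE A,{w}) for `G/T` at `t₀`**
(for `s, w ∉ T`, `t₀ ∈ T`): the five probabilities of `Gate.GateRow` coincide. -/
theorem gateRow_contract_rep_iff (p : E → R) (ht₀ : t₀ ∈ T) {s : V} (hs : s ∉ T) (a b : V)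
    (A : Finset V) {w : V} (hw : w ∉ T) :
    Gate.GateRow p (Contract.contractEnds ends T t₀) s {t₀} a b A {w} ↔
      Gate.GateRow p ends s T a b A {w} := by
  unfold Gate.GateRow
  rw [connAll_inter_gateEvent_contract_rep ht₀ hs hw A ({a} ∪ {b}),
    connAll_inter_gateEvent_contract_rep ht₀ hs hw A {a},
    connAll_inter_gateEvent_contract_rep ht₀ hs hw A {b},
    connAll_inter_avoidAll_contract_rep ht₀ hs {a}, connAll_inter_avoidAll_contract_rep ht₀ hs {b},
    avoidAll_contract_rep ht₀ hs, gateEvent_contract_rep ht₀ hs hw A]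

end Row

/-! ## The forest part of `G/T` at `t₀` is `G − T` -/

section Forest

variable {ends : E → Sym2 V} {T : Finset V} {t₀ : V}

/-- The edge family of `G − T` (the edges avoiding `T`), on the subtype of such edges. -/
def endsDel (ends : E → Sym2 V) (T : Finset V) : {e // ∀ t ∈ T, t ∉ ends e} → Sym2 V :=
  fun e => ends e.1

/-- An edge avoiding `T` is unchanged by the contraction. -/
lemma map_contractMap_of_avoid {e : E} (he : ∀ t ∈ T, t ∉ ends e) :
    (ends e).map (Contract.contractMap T t₀) = ends e := by
  obtain ⟨x, y, hxy⟩ : ∃ x y, ends e = s(x, y) :=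
    (Sym2.exists (f := fun z => ends e = z)).1 ⟨ends e, rfl⟩
  have hx : x ∉ T := fun hx => he x hx (by rw [hxy]; exact Sym2.mem_mk_left x y)
  have hy : y ∉ T := fun hy => he y hy (by rw [hxy]; exact Sym2.mem_mk_right x y)
  rw [hxy, Sym2.map_mk, Contract.contractMap_of_notMem hx, Contract.contractMap_of_notMem hy]

/-- The edges of `G/T` not at `t₀` are exactly the edges of `G` avoiding `T`. -/
lemma Ft_contract_eq (ht₀ : t₀ ∈ T) :
    GateFeedback.Ft (Contract.contractEnds ends T t₀) t₀ = {e | ∀ t ∈ T, t ∉ ends e} := by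
  ext e
  simp only [GateFeedback.Ft, Set.mem_setOf_eq, Contract.contractEnds_apply]
  constructor
  · intro h t ht hte
    exact h (Sym2.mem_map.2 ⟨t, hte, Contract.contractMap_of_mem ht⟩)
  · intro h hmem
    obtain ⟨y, hy, hyt⟩ := Sym2.mem_map.1 hmem
    by_cases hyT : y ∈ T
    · exact h y hyT hy
    · rw [Contract.contractMap_of_notMem hyT] at hyt
      exact h y (hyt ▸ ht₀) hy

/-- **`G − T` a forest ⟹ the forest part of `G/T` at `t₀` is a forest.** -/
theorem isForest_endsF_contract (ht₀ : t₀ ∈ T) (hF : Hull.IsForest (endsDel ends T)) :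
    Hull.IsForest (GateFeedback.endsF (Contract.contractEnds ends T t₀) t₀) := by
  have hset := Ft_contract_eq (ends := ends) ht₀
  have h1 : GateFeedback.endsF (Contract.contractEnds ends T t₀) t₀ = fun e => ends e.1 := by
    funext e
    have he : ∀ t ∈ T, t ∉ ends e.1 := (Set.ext_iff.1 hset e.1).1 e.2
    exact map_contractMap_of_avoid he
  rw [h1, hset]
  exact hF

end Forest

/-! ## The theorems -/

section Theorem

variable [Fintype E] [Fintype V]
variable {R : Type*} [Field R] [LinearOrder R] [IsStrictOrderedRing R]

/-- **THEOREM (feedback-vertex-SET gate).** If every cycle of `G` meets the avoided set `T`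
(`G − T` is a forest), then `(GATE A,{w})` — in particular the free one-sided gate — holds for
every root `s ∉ T`, markers `a, b`, entry set `A` and exit vertex `w ∉ T`:
`Gate.GateRow s T a b A {w}`. -/
theorem gateRow_of_isForest_del_set {p : E → R} (hp : IsProbVec p) {ends : E → Sym2 V}
    (s : V) (T : Finset V) (t₀ : V) (a b w : V) (A : Finset V) (ht₀ : t₀ ∈ T) (hs : s ∉ T)
    (hw : w ∉ T) (hF : Hull.IsForest (endsDel ends T)) :
    Gate.GateRow p ends s T a b A {w} := by
  rw [← gateRow_contract_rep_iff p ht₀ hs a b A hw]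
  exact GateFeedback.gateRow_general_of_isForest_del hp s t₀ a b w A
    (isForest_endsF_contract ht₀ hF) (fun h => hw (by rw [h]; exact ht₀))

/-- The free one-sided gate `(ARC u⇐w)` at an avoided set `T` meeting every cycle. -/
theorem gateRow_free_of_isForest_del_set {p : E → R} (hp : IsProbVec p) {ends : E → Sym2 V}
    (s : V) (T : Finset V) (t₀ : V) (a b u w : V) (ht₀ : t₀ ∈ T) (hs : s ∉ T) (hw : w ∉ T)
    (hF : Hull.IsForest (endsDel ends T)) :
    Gate.GateRow p ends s T a b {u} {w} :=
  gateRow_of_isForest_del_set hp s T t₀ a b w {u} ht₀ hs hw hF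

end Theorem

end GateContract

end Summit.Ventures.PercRepro2
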